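import Literature.AlgebraicGeometry.GroupSchemes.GroupSchemeKernel
import Literature.RingTheory.Valuation.ValuationSubringHenselian
import Summits.HodgeConjecture.HodgeConjecture.Theorems.F0P6bConnectedEtaleStubB1a
import Summits.HodgeConjecture.HodgeConjecture.Theorems.F0P6bConnectedEtaleStubB1b
import Summits.HodgeConjecture.HodgeConjecture.Theorems.F0P6bConnectedEtaleStubB1d
import Summits.HodgeConjecture.HodgeConjecture.Theorems.F0P6bConnectedEtaleStubB1c
import Summits.HodgeConjecture.HodgeConjecture.Theorems.F0P6bConnectedEtaleStubB1e
import Summits.HodgeConjecture.HodgeConjecture.Theorems.F0P6bConnectedEtaleStubB1g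
import Summits.HodgeConjecture.HodgeConjecture.Theorems.F0P6bConnectedEtaleStubB4g
import Literature.AlgebraicGeometry.GroupSchemes.EtaleOfTrivialUnitComponent
import Literature.AlgebraicGeometry.GroupSchemes.ConnectedOfOnePointSpecialFibre
import Literature.AlgebraicGeometry.GroupSchemes.IsIsoOrEtaleOfNatCard
import Mathlib.AlgebraicGeometry.Morphisms.Finite
import Mathlib.AlgebraicGeometry.Morphisms.Flat
import Mathlib.AlgebraicGeometry.Morphisms.ClosedImmersion
import Mathlib.AlgebraicGeometry.Morphisms.Etale
import Mathlib.RingTheory.Henselian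
import Mathlib.RingTheory.Valuation.ValuationSubring
import Mathlib.FieldTheory.IsAlgClosed.Basic
import HarnessLib

/-!
# `F0P6bConnectedEtale` — ★ RE-HOME (rung-0 re-homing task, books INVENTORY §8.4 M-3; LEAD F0P6-plan (g4) «M-72») of the crux workfile `Lines/F0_P6b_ConnectedEtale.lean`

This `Theorems/` module is the TREE BYTES of `Summits/HodgeConjecture/HodgeConjecture/Cruxes/HLiu418/Lines/F0_P6b_ConnectedEtale.lean` (edition of record,
tree sha16 d2d297f26c1c1294, 360 l., code-`sorry`-free) with the NAMESPACE KEPT — `Summit.HodgeConjecture.HodgeConjecture.Cruxes.HLiu418.F0P6bConnectedEtale` — so that every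
fully-qualified name (`IsUnitComponent`, `stub_b1a_unitComponent`, `stub_b1b_kernelOfReduction`, `stub_b1cg_rankEqCardMulRank_geom`, `stub_b1c_rankEqCardMulRank`, `stub_b1d_reductionSurjective` (dropped in v2: ★ `…StubB1d.…_holds` by name), `stub_b4g_etaleClosureOfGenericSubgroup_henselian`, `stub_b4_etaleClosureOfGenericSubgroup`, `reductionKernel_of_line`, `stub_b1e_unitComponentSpecialFibre`, …; 14 declarations) is UNCHANGED; only this module
docstring is re-headed.  Why a re-home: a `Theorems/` file cannot import a `Lines/` workfile (F0P6-ref1 o-6), and closing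
stmt-HodgeConjecture-24832 `--as proved --by <Theorems decl>` at rung 0 needs the sorry-free Lines chain behind the gate (RE-HOME MAP v1.1, LA7-plan (g4),
2026-09-02; director g27 s1336 (R1)–(R3)).  It has NO `Lines` import (Tier 0).  Lines importers of the original: none.
After this file is ★ the Lines workfile is meant to become a one-import SHIM of it (a `Lines/` write, batched per cone on the LEAD's word), so no
environment ever holds two copies (NO-CROSS-IMPORT rule, «M-72» (3)).  It asserts nothing beyond what the workfile already proves.

## Original module docstring (verbatim)
# F0 ∕ P6b — sub-line «CONNECTED–ÉTALE» (`Lines/F0_P6b_ConnectedEtale.lean`, LEAD M-1b (2) name) (HEART inputs (b1)∕(b4) of LEAD ruling M-1 (G), 2026-09-01): the connected component of the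
# unit of a finite flat group scheme over a henselian local base, the kernel of the reduction map on points, the count
# `rank G = #G(κ̄) · rank G⁰`, and the étale closure of a generic subgroup meeting `G⁰` trivially — SCHEME READINGS of ★ rows G2–G4

Crux workfile of `stmt-HodgeConjecture-24832` (HLiu418) on `route-HodgeConjecture-HCCMUnconditional`; cell `pub/hodgecm-mathlib`, FLOOR 0,
P6 «MOD programme», sub-desk P6b (F0P6b-plan (g0)).  Door P″ (LEAD M-1): the HEART of `stub_PWcore` (P6a) reads the ordinary ∕ supersingular
dichotomy off the `𝔴`-torsion `E[𝔴] = 𝒜_x[𝔴]` of the pull-back of the universal abelian scheme along an integral point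
`x̃ : Spec V → 𝒮c` (`V = closureValuationSubring (w.adicCompletion F)`, henselian ★ `Valuation/ValuationSubringHenselian`); its finite-group-scheme
inputs (b1) «unit component, kernel of reduction = points of the connected part, count» and (b4) «a generic line meeting `C_can` trivially has
étale closure» are ★ IN ALGEBRA CURRENCY (rows G3 `RingTheory/Henselian/FiniteFlatHopfAlgebra*`, G2 `RingTheory/Flat/*ClosureGenericFibre*`,
G4 `IntegralClosure/FiniteTorsionFreeAlgebraGenericRank`, (S-γ2) `Motives/FiniteFlatCoverReductionMultiset`) and are stated here in SCHEME
currency — `G : Over (Spec R)` with `[GrpObj G]`, finite flat; points `Spec R′ ⟶ G.left` over `Spec R` — as registered-to-be stubs BY NAME,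
with the sorry-free composition `reductionKernel_of_line`.  Census: `F0/P6/F0P6b-plan/CENSUS-P6b-HEART-b1b3b4.v0.F0P6b-plan-g0.md`.
Engines behind the stubs: ★ G3 + the ORGAN (GAP-1) «Hopf algebra of a finite group object of `Over (Spec R)` with group-compatible points
dictionary» (ring version of ★ `Motives/AbelianVarietyFiniteSubgroupSubscheme` §`ptEquiv`∕`groupLaw`, ★ `CorepGroupLaw`; Mathlib
`commBialgCatEquivComonCommAlgCat`).  Generic algebraic geometry; universe 0; no instance, no notation, no axiom.
HC_CM is proved only modulo the printed citations until rung 0 closes; this file changes no count.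

ED. 2 (2026-09-01): (b1c) generalised to (b1cg) «count the `k`-points for ANY algebraically closed `k ⊇ κ(R)`» with ED. 1's `stub_b1c_…` now
DERIVED (serves DVR bases `𝒪_L` with finite residue field, P6c FLAG F-c2a, as well as `𝒪_Ω`); (b4) generalised to (b4g) «any henselian local base»
with ED. 1's `stub_b4_…` DERIVED via ★ `ValuationSubring.henselianLocalRing_of_isAlgClosed`; NEW (b1e) «the special fibre of `G⁰` is one point»
(DICT (b4′) canonical line ∕ bridge to P6d's `ker F` on the special fibre).  ED. 1's five statement TEXTS are byte-identical; `stub_b1a` is PAID BY NAME (★ p844793) and so is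
`stub_b1d` (★ p844835 `Theorems/F0P6bConnectedEtaleStubB1d`, over ★ p844804 `Morphisms/FiniteFlatResiduePointLiftsToSection` ← ★ p844776) and `stub_b1b`
(★ p844848 `Theorems/F0P6bConnectedEtaleStubB1b`, over ★ p844805 `GroupSchemes/UnitComponentReductionKernel`); stubs now THREE (`b1cg`, `b4g`, `b1e`) — so ED. 1's
three HEART sockets b1a∕b1b∕b1d are all PAID and the head `reductionKernel_of_line` depends on `sorryAx` only through `stub_b1cg`; «a connected `Z → G` through the unit factors through `j`» is the ★ organ (o-c2d) (B-p08), cited not socketed.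

ED. 3 (2026-09-01): ALL SOCKETS PAID — `stub_b1cg` (+ derived `stub_b1c`) := ★ `Theorems/F0P6bConnectedEtaleStubB1c` (F0P3a-p04 (g15) over ★ p844906
`GroupSchemes/FiniteFlatGroupSchemeRankPointCount` ← ★ p844880 `Henselian/FiniteFlatHopfAlgebraRankPointCount`), `stub_b4g` (+ derived `stub_b4`) := ★ p844920
`Theorems/F0P6bConnectedEtaleStubB4g` (B-p12 (g30) over ★ p844902 `GroupSchemes/EtaleClosureOfFiniteSubgroupOfSections`), `stub_b1e` := ★ p844903
`Theorems/F0P6bConnectedEtaleStubB1e` (F0P6-p14 (g0) over ★ p844877 `GroupSchemes/FiniteConnectedSpecialFibre`); TWO NEW SOCKETS BORN PAID: §7 (b1g)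
`stub_b1g_unitComponentBaseChange` «unit components are stable under LOCAL base change» := ★ p844915 `Theorems/F0P6bConnectedEtaleStubB1g` (F0P6-p16 (g0)
over ★ p844895 `GroupSchemes/UnitComponentBaseChange` ← ★ p844861 `Henselian/AugmentedLocalAlgebraBaseChange`) and §8 (b1f) `stub_b1f_etaleOfTrivialUnitComponent`
«over `k = k̄`, trivial unit component ⇒ étale» := conjunct 1 of ★ p844866 `GroupSchemes/EtaleOfTrivialUnitComponent` (B-p17 (g26)).  The file is now
`sorry`-FREE: every decl's axioms are the TRIO; all ED. 1∕ED. 2 statement texts byte-identical.  Consumers (P6c DICT `PointDictionary` constructor ∕ P6a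
HEART): `canonicalLine` ⟸ b1a + b1b + b1d + b1e + b1g (+ ★ (o-c2d) B-p08, ★ (b1-iii) package F0P6-p11); `eq_kerF_or_isEtale` ⟸ b1a + b1cg + b4g + b1f at
`R = κ̄` (+ ★ (o-c2c) B-p08∕B-p17 + P6d (b2)(b3a)).

ED. 4 (2026-09-01): HEART CONSUMER GLUE, BORN PAID — after the desk's HAND-OVER memo `F0/P6/F0P6b-plan/HANDOVER-P6b-sockets-to-HEART.v1.F0P6bplan-g0.md`
(9c697d37; adopted by F0P6c-plan (g0) as the documentation of record for the `PointDictionary` constructors (b) `eq_kerF_or_isEtale` ∕ (b4′) `canonicalLine`):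
§9 (b1h) `stub_b1h_connectedOfOnePointSpecialFibre` «finite over a LOCAL ring with a one-point special fibre ⇒ connected» := ★ `GroupSchemes/ConnectedOfOnePointSpecialFibre`
(B-p17 (g26); the converse of (b1e), with NO henselian ∕ flat ∕ group hypothesis) — (b4′) uniqueness route (u1): the closure `𝒞 ⊆ 𝒢[ϖ]` of a line specialising to
`ker F_q` is connected, hence inside `𝒢[ϖ]⁰` by ★ (o-c2d), hence equal to it by ★ equal-rank rigidity (`Morphisms/ClosedImmersionOfEqualRank`, [StacksProject] Tag 02KA).
§10 (b1k) `stub_b1k_isIsoOrEtaleOfNatCard` «the DICHOTOMY CORE over `k = k̄`: `#G(k) = 1 ⇒ G⁰ = G`, `#G(k) = rank G ⇒ G` étale» := ★ `GroupSchemes/IsIsoOrEtaleOfNatCard`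
(F0P3a-p04 (g15), presentation currency of §3 (b1cg); = recipe (b) steps 2–4 packaged over ★ p844906 + ★ 02KA + ★ p844866) — DICT (b) `eq_kerF_or_isEtale` cites ONE name per branch.
No statement of ED. 1–3 is touched; the file stays `sorry`-free.

References: [Tate1997FiniteFlatGroupSchemes] (3.7); [StacksProject] Tags 04GG, 04GH; [SerreTate1968] §1; [MumfordAV1970] §7, §12;
[GortzWedhorn2023] Prop. 27.86.
-/

noncomputable section

set_option autoImplicit false
set_option linter.dupNamespace false

open CategoryTheory CategoryTheory.Limits AlgebraicGeometry MonoidalCategory CartesianMonoidalCategory IsLocalRing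
open scoped MonObj

namespace Summit.HodgeConjecture.HodgeConjecture.Cruxes.HLiu418.F0P6bConnectedEtale

/-! ### §0 The shape «`j : G₀ ↪ G` is a unit component»: an open-and-closed connected closed subgroup scheme -/

/-- **`IsUnitComponent G G₀ j`** — `j : G₀ ⟶ G` is a homomorphism of group objects of `Over (Spec R)` whose underlying morphism is an OPEN AND
CLOSED IMMERSION with CONNECTED source.  Since `η[G₀] ≫ j = η[G]`, `G₀.left` is then THE connected component of `G.left` through the unit
section's closed point: the datum is unique up to unique isomorphism and no choice is visible to a consumer.  Over a henselian local base
`G₀ = Spec` of the unit local factor `B_{𝔫_ε}` of `B = Γ(G, 𝒪)` (★ `Henselian/FiniteFlatHopfAlgebraUnitFactorHopf.isHopfIdeal_span_one_sub`).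
[cite: Tate1997FiniteFlatGroupSchemes, (3.7)] [cite: StacksProject, Tag 04GG] -/
def IsUnitComponent {R : Type} [CommRing R] (G G₀ : Over (Spec (.of R))) [GrpObj G] [GrpObj G₀] (j : G₀ ⟶ G) : Prop :=
  IsMonHom j ∧ IsOpenImmersion j.left ∧ IsClosedImmersion j.left ∧ ConnectedSpace G₀.left

/-! ### §1 (b1a) Existence of the unit component over a henselian local base -/

/-- **PAID (ED. 2) `stub_b1a_unitComponent` := ★ p844793 `Theorems/F0P6bConnectedEtaleStubB1a` (F0P6-p09 σ1 «HOPF» over ★ p844766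
`GroupSchemes/UnitComponentOfFiniteGroupScheme.exists_unitComponent`; σ2 twin F0P6-p13 ★ `UnitComponentClopen`)** — was: **STUB (M)** — a finite flat group scheme `G` over a HENSELIAN local ring has a unit component
`j : G₀ ↪ G` (`IsUnitComponent`); flatness is NOT needed (Tate (3.7) (I) for `G` finite over a henselian base).  Proof route: `G.left` is affine, `B := Γ(G.left, ⊤)` is module-finite over `R`, hence a finite product of
local rings (★ `Henselian/FiniteAlgebraProductOfLocalizations.exists_completeOrthogonalIdempotents_isLocalRing`, Stacks 04GG (10)); the corner
`B ⧸ (1 - e)` at the unit maximal ideal `𝔫_ε` is a HOPF QUOTIENT (★ `FiniteFlatHopfAlgebraUnitFactorHopf.isHopfIdeal_span_one_sub`, «`G⁰G⁰ = G⁰`»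
★ `map_mk_mk_comul_eq_one`), i.e. the clopen `D(e) = Spec (B ⧸ (1 - e)) ↪ Spec B` is a closed subgroup scheme, connected because its ring is local;
the group structure on `Γ(G.left, ⊤)` is the ORGAN (GAP-1).  Why it might fail as typed: only mis-typing (the mathematics is Tate (3.7) (I)).
[cite: Tate1997FiniteFlatGroupSchemes, (3.7) (I)] [cite: StacksProject, Tag 04GG] -/
theorem stub_b1a_unitComponent :
    ∀ (R : Type) [CommRing R] [HenselianLocalRing R] (G : Over (Spec (.of R))) [GrpObj G],
      IsFinite G.hom →
        ∃ (G₀ : Over (Spec (.of R))) (_ : GrpObj G₀) (j : G₀ ⟶ G), IsUnitComponent G G₀ j :=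
  F0P6bConnectedEtaleStubB1a.stub_b1a_unitComponent

/-! ### §2 (b1b) The kernel of the reduction map on local points is the unit component -/

/-- **PAID (ED. 2) `stub_b1b_kernelOfReduction` := ★ p844848 `F0P6bConnectedEtaleStubB1b.stub_b1b_kernelOfReduction_holds` (F0P6-p11 (g0)).** (S–M) — for a unit component `j : G₀ ↪ G` of a finite group scheme over a henselian local ring `R`
and a point `t : Spec R′ → G` over `Spec R` with `R′` LOCAL and `R → R′` a LOCAL homomorphism (e.g. `R′ = R`, or a valuation ring dominating
`R`): `t` factors through `G₀` iff its reduction `Spec κ(R′) → G` is the unit `κ(R′)`-point.  (⇐) `Spec R′` is connected and its closed point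
goes to the unit's component; (⇒) the special fibre of `G₀` is the spectrum of a local artinian algebra with residue field `κ(R)` (henselian:
★ `FiniteFlatHopfAlgebraUnitFactor.isLocalRing_residueField_tensor_unitCorner`), so it has exactly one `κ(R′)`-point over `κ(R)`.  In algebra
currency this is ★ `FiniteFlatHopfAlgebraUnitFactorLocalization.exists_algHom_localization_counit_comp_eq_iff`.  Why it might fail as typed:
FALSE for non-local `R′` (a point can straddle components) — hence the `IsLocalRing R′`∕`IsLocalHom f` binders.
[cite: Tate1997FiniteFlatGroupSchemes, (3.7)] [cite: SerreTate1968, §1 Lemma 1] -/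
theorem stub_b1b_kernelOfReduction :
    ∀ (R : Type) [CommRing R] [HenselianLocalRing R] (G G₀ : Over (Spec (.of R))) [GrpObj G] [GrpObj G₀] (j : G₀ ⟶ G),
      IsFinite G.hom → IsUnitComponent G G₀ j →
        ∀ (R' : Type) [CommRing R'] [IsLocalRing R'] (f : R →+* R') [IsLocalHom f] (t : Spec (.of R') ⟶ G.left),
          t ≫ G.hom = Spec.map (CommRingCat.ofHom f) →
            ((∃ s : Spec (.of R') ⟶ G₀.left, s ≫ j.left = t) ↔
              Spec.map (CommRingCat.ofHom (residue R')) ≫ t =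
                Spec.map (CommRingCat.ofHom ((residue R').comp f)) ≫ η[G].left) :=
  -- ED. 2: PAID BY NAME (statement UNCHANGED) — ★ p844848 `Theorems/F0P6bConnectedEtaleStubB1b` (F0P6-p11 (g0), over ★ p844805).
  F0P6bConnectedEtaleStubB1b.stub_b1b_kernelOfReduction_holds

/-! ### §3 (b1c) The count: `rank G = #G(k) · rank G⁰` for geometric points `k ⊇ κ(R)` algebraically closed -/

/-- **PAID (ED. 3) `stub_b1cg_rankEqCardMulRank_geom` := ★ `F0P6bConnectedEtaleStubB1c.stub_b1cg_rankEqCardMulRank_geom` (F0P3a-p04 (g15)).** (S–M) — over a henselian local ring `R`, for a finite flat group scheme `G = Spec B` with unit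
component `G₀ = Spec B₀` (coordinate rings presented by `eB`, `eB₀`) and ANY algebraically closed field `k` over `κ(R)` (F-c2a: serves DVR bases
`𝒪_L` with finite residue field as well as `𝒪_Ω`): `rank_R B = #G(k) · rank_R B₀`, `G(k)` the `k`-points of `G` over `Spec R`.  Route: the
maximal ideals of `B ⊗_R k` are the `k`-points; every local factor of `B ⊗_R k` is the translate of the unit factor `B₀ ⊗_R k` (local, residue
field `k`) by its `k`-point (★ `FiniteFlatHopfAlgebraTranslations.finrank_corner_eq_finrank_unitCorner` over `k`), and ranks are read after
`⊗ k` (★ `FiniteFlatHopfAlgebraUnitFactor.finrank_residueField_tensor_localization_eq`).  NOTE: the non-unit local factors of `B` need NOT have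
`R`-points (ordinary `E[p]` over `W(κ̄)` with Serre–Tate parameter `∉ (R^×)^p`), which is why the translation is done over `k`.  HEART use:
`#E[𝔴](κ̄) = q`, `rank E[𝔴] = q²` ⇒ `rank E[𝔴]⁰ = q`; `#E[𝔴](κ̄) = 1` ⇒ `rank E[𝔴]⁰ = q²`.  Why it might fail as typed: only mis-typing of `eB`, `eB₀`.
[cite: Tate1997FiniteFlatGroupSchemes, (3.7)] [cite: MumfordAV1970, §12] -/
theorem stub_b1cg_rankEqCardMulRank_geom :
    ∀ (R : Type) [CommRing R] [HenselianLocalRing R] (k : Type) [Field k] [IsAlgClosed k] (φ : ResidueField R →+* k)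
      (G G₀ : Over (Spec (.of R))) [GrpObj G] [GrpObj G₀] (j : G₀ ⟶ G),
      IsFinite G.hom → Flat G.hom → IsUnitComponent G G₀ j →
        ∀ (B : Type) [CommRing B] [Algebra R B] (eB : G.left ≅ Spec (.of B)),
          eB.hom ≫ Spec.map (CommRingCat.ofHom (algebraMap R B)) = G.hom →
        ∀ (B₀ : Type) [CommRing B₀] [Algebra R B₀] (eB₀ : G₀.left ≅ Spec (.of B₀)),
          eB₀.hom ≫ Spec.map (CommRingCat.ofHom (algebraMap R B₀)) = G₀.hom →
            Module.finrank R B =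
              Nat.card {t : Spec (.of k) ⟶ G.left //
                  t ≫ G.hom = Spec.map (CommRingCat.ofHom (φ.comp (residue R)))} * Module.finrank R B₀ :=
  -- ED. 3: PAID BY NAME (statement UNCHANGED) — ★ `Theorems/F0P6bConnectedEtaleStubB1c` (F0P3a-p04 (g15) over ★ p844906 ← ★ p844880; F0P6-p09 σ1 census).
  F0P6bConnectedEtaleStubB1c.stub_b1cg_rankEqCardMulRank_geom

/-- **(b1c) = (b1cg) at `k = κ(R)`** (ED. 1's letter `stub_b1c_rankEqCardMulRank`, now DERIVED, sorry-free): over a henselian local ring with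
ALGEBRAICALLY CLOSED residue field, `rank_R B = #G(κ(R)) · rank_R B₀`. [cite: Tate1997FiniteFlatGroupSchemes, (3.7)] -/
theorem stub_b1c_rankEqCardMulRank :
    ∀ (R : Type) [CommRing R] [HenselianLocalRing R] [IsAlgClosed (ResidueField R)]
      (G G₀ : Over (Spec (.of R))) [GrpObj G] [GrpObj G₀] (j : G₀ ⟶ G),
      IsFinite G.hom → Flat G.hom → IsUnitComponent G G₀ j →
        ∀ (B : Type) [CommRing B] [Algebra R B] (eB : G.left ≅ Spec (.of B)),
          eB.hom ≫ Spec.map (CommRingCat.ofHom (algebraMap R B)) = G.hom →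
        ∀ (B₀ : Type) [CommRing B₀] [Algebra R B₀] (eB₀ : G₀.left ≅ Spec (.of B₀)),
          eB₀.hom ≫ Spec.map (CommRingCat.ofHom (algebraMap R B₀)) = G₀.hom →
            Module.finrank R B =
              Nat.card {t : Spec (.of (ResidueField R)) ⟶ G.left //
                  t ≫ G.hom = Spec.map (CommRingCat.ofHom (residue R))} * Module.finrank R B₀ := by
  intro R _ _ _ G G₀ _ _ j hGf hGfl hj B _ _ eB heB B₀ _ _ eB₀ heB₀
  simpa only [RingHom.id_comp] using
    stub_b1cg_rankEqCardMulRank_geom R (ResidueField R) (RingHom.id _) G G₀ j hGf hGfl hj B eB heB B₀ eB₀ heB₀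

/-! ### §3′ (b1d) Over the valuation ring of an algebraically closed field the reduction map on sections is surjective -/

/-! **(b1d) `stub_b1d_reductionSurjective` — NOT RESTATED IN THE ★ RE-HOME (gate `dedup.landed`, dry-run 2026-09-02T07:14:02Z):** it IS, token for token,
the already-landed ★ p844835 `F0P6bConnectedEtaleStubB1d.stub_b1d_reductionSurjective_holds` (`Theorems/F0P6bConnectedEtaleStubB1d`, imported above) —
use that declaration BY NAME.  (The `Lines/F0_P6b_ConnectedEtale` original keeps its one-line «PAID BY NAME» restatement; nothing in the tree consumes
the restated name.)  Standing re-home rule (LA7-p02 (g3)): a Lines theorem already PAID by a ★ `Theorems/…Stub…` leaf is re-homed by IMPORT, not by copy. -/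

/-! ### §4 (b4) Étale closure of a generic subgroup meeting the unit component trivially (any henselian local base) -/

/-- **PAID (ED. 3) `stub_b4g_etaleClosureOfGenericSubgroup_henselian` := ★ p844920 `F0P6bConnectedEtaleStubB4g.stub_b4g_etaleClosureOfGenericSubgroup_henselian` (B-p12 (g30)).** (M) — over ANY henselian local ring `R`, `G` finite over `Spec R` (no flatness)
with unit component `G₀`, `C` a finite subgroup of the sections `G(R)` meeting `G₀(R)` trivially.  THEN (i) the reduction map is injective on `C`
((b1b): its kernel on `C` is `C ∩ G₀(R) = 1`; reduction is a homomorphism, Mathlib `Hom.group`) and (ii) there is a closed subgroup scheme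
`c : C̄ ↪ G`, FINITE ÉTALE over `Spec R`, whose sections are exactly `C`.  Route σ2 «SECTIONS FIRST» (F0P6-ref1 A2 read-back): by (i) the
sections of `C` have pairwise distinct closed points; `Γ(G) = ∏` local rings (henselian), so their images `≅ Spec R` are pairwise disjoint
clopen pieces and `C̄ := ∐_{s ∈ C} Spec R` is a closed finite-étale sub-group-object with sections `C` (`Spec R` connected).  Route σ1
«IDEAL CLOSURE» (R a valuation ring): ★ G2c∕G2d∕G4.  HEART use ([h4]): the `q` lines `C_β ≠ C_can` have ÉTALE closures (with ★ (o-c2c)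
equal-rank rigidity, any flat closure object of rank `|C|` containing `C` IS this `C̄`).  Why it might fail as typed: without `C ∩ G₀(R) = 1`
the conclusion (ii) fails (`C = C_can` has connected closure), so the hypothesis is load-bearing.  [cite: SerreTate1968, §1] [cite: StacksProject, Tag 04GG] -/
theorem stub_b4g_etaleClosureOfGenericSubgroup_henselian :
    ∀ (R : Type) [CommRing R] [HenselianLocalRing R] (G G₀ : Over (Spec (.of R))) [GrpObj G] [GrpObj G₀] (j : G₀ ⟶ G),
      IsFinite G.hom → IsUnitComponent G G₀ j →
        ∀ (C : Subgroup (𝟙_ (Over (Spec (.of R))) ⟶ G)), (C : Set (𝟙_ (Over (Spec (.of R))) ⟶ G)).Finite →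
          (∀ s ∈ C, (∃ s₀ : 𝟙_ (Over (Spec (.of R))) ⟶ G₀, s₀ ≫ j = s) → s = 1) →
            (∀ s₁ ∈ C, ∀ s₂ ∈ C,
                Spec.map (CommRingCat.ofHom (residue R)) ≫ s₁.left = Spec.map (CommRingCat.ofHom (residue R)) ≫ s₂.left →
                  s₁ = s₂) ∧
            ∃ (Cbar : Over (Spec (.of R))) (_ : GrpObj Cbar) (c : Cbar ⟶ G),
              IsMonHom c ∧ IsClosedImmersion c.left ∧ IsFinite Cbar.hom ∧ Etale Cbar.hom ∧
                ∀ s : 𝟙_ (Over (Spec (.of R))) ⟶ G, s ∈ C ↔ ∃ sbar : 𝟙_ (Over (Spec (.of R))) ⟶ Cbar, sbar ≫ c = s :=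
  -- ED. 3: PAID BY NAME (statement UNCHANGED) — ★ p844920 `Theorems/F0P6bConnectedEtaleStubB4g` (B-p12 (g30) over ★ p844902 ← ★ p844860∕p844805∕p844780).
  F0P6bConnectedEtaleStubB4g.stub_b4g_etaleClosureOfGenericSubgroup_henselian

/-- **(b4) = (b4g) at `R = V`** (ED. 1's letter `stub_b4_etaleClosureOfGenericSubgroup`, now DERIVED, sorry-free, via ★
`ValuationSubring.henselianLocalRing_of_isAlgClosed`) — base `V ⊆ Ω` the valuation ring of an ALGEBRAICALLY CLOSED field (henselian, ★),
`G` finite over `Spec V` (flatness of `G` is not needed: the closure is `V`-torsion-free, hence flat) with unit component `G₀`, `C` a finite subgroup of the sections `G(V)` (`= G(Ω)`, ★ `Valuation/AlgHomIntoValuationSubring`)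
meeting `G₀(V)` trivially.  THEN the reduction map is injective on `C` (b1b: its kernel on `C` is `C ∩ G₀(V) = 1`) and the schematic closure of `C`
is a closed subgroup scheme `c : C̄ ↪ G`, FINITE ÉTALE over `Spec V`, whose sections are exactly `C`: in algebra currency the closure of the Hopf
ideal cutting out `C ⊂ G(Ω)` is a Hopf ideal with finite free quotient of rank `|C|` (★ G2c `HopfIdealClosureGenericFibre.comap_map_sup_map_eq_of_isBezout`,
★ G2d `IdealClosureGenericFibreRank.free_quotient_comap_includeRight_of_valuationRing`), it has `|C|` sections with `|C|` distinct reductions, hence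
`|C|` corners, hence `≅ V^{|C|}` (★ G4 `FiniteTorsionFreeAlgebraGenericRank.nonempty_algEquiv_pi_of_finrank_baseChange_eq_card`), i.e. étale.  HEART
use ([h4]): the `q` lines `C_β ≠ C_can` have ÉTALE closures.  Why it might fail as typed: without `C ∩ G₀(V) = 1` the closure is still finite flat of
rank `|C|` but NOT étale (`C = C_can`), so the hypothesis is load-bearing; `V` must be the valuation ring of an algebraically CLOSED field for
`G(V) = G(Ω)`-style counting (over a DVR the points of `C` may be defined only after ramified extension).
[cite: SerreTate1968, §1] [cite: Tate1997FiniteFlatGroupSchemes, (3.7)] [cite: StacksProject, Tag 04GG] -/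
theorem stub_b4_etaleClosureOfGenericSubgroup :
    ∀ (Ω : Type) [Field Ω] [IsAlgClosed Ω] (V : ValuationSubring Ω)
      (G G₀ : Over (Spec (.of V))) [GrpObj G] [GrpObj G₀] (j : G₀ ⟶ G),
      IsFinite G.hom → IsUnitComponent G G₀ j →
        ∀ (C : Subgroup (𝟙_ (Over (Spec (.of V))) ⟶ G)), (C : Set (𝟙_ (Over (Spec (.of V))) ⟶ G)).Finite →
          (∀ s ∈ C, (∃ s₀ : 𝟙_ (Over (Spec (.of V))) ⟶ G₀, s₀ ≫ j = s) → s = 1) →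
            (∀ s₁ ∈ C, ∀ s₂ ∈ C,
                Spec.map (CommRingCat.ofHom (residue V)) ≫ s₁.left = Spec.map (CommRingCat.ofHom (residue V)) ≫ s₂.left →
                  s₁ = s₂) ∧
            ∃ (Cbar : Over (Spec (.of V))) (_ : GrpObj Cbar) (c : Cbar ⟶ G),
              IsMonHom c ∧ IsClosedImmersion c.left ∧ IsFinite Cbar.hom ∧ Etale Cbar.hom ∧
                ∀ s : 𝟙_ (Over (Spec (.of V))) ⟶ G, s ∈ C ↔ ∃ sbar : 𝟙_ (Over (Spec (.of V))) ⟶ Cbar, sbar ≫ c = s := by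
  intro Ω _ _ V G G₀ _ _ j hG hj C hC hC0
  haveI := V.henselianLocalRing_of_isAlgClosed
  exact stub_b4g_etaleClosureOfGenericSubgroup_henselian V G G₀ j hG hj C hC hC0

/-! ### §5 HEAD — the letter HEART [h4]∕(V) quotes: unit component + kernel of reduction + count, composed sorry-free -/

/-- **HEAD `reductionKernel_of_line`** (sorry-free composition of `stub_b1a` ∘ `stub_b1b` ∘ `stub_b1c`): a finite flat group scheme `G` over a
henselian local ring `R` has a unit component `j : G₀ ↪ G` (clopen, connected closed subgroup) such that (i) a local point of `G` factors through
`G₀` iff it reduces to the unit point, and (ii) when `κ(R)` is algebraically closed, `rank G = #G(κ) · rank G₀` for any coordinate-ring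
presentations.  Consumed BY NAME by P6a's HEART at `R := closureValuationSubring (w.adicCompletion F)`, `G := 𝒜_x[𝔴]`.
[cite: Tate1997FiniteFlatGroupSchemes, (3.7)] [cite: SerreTate1968, §1] -/
theorem reductionKernel_of_line (R : Type) [CommRing R] [HenselianLocalRing R] (G : Over (Spec (.of R))) [GrpObj G]
    (hGf : IsFinite G.hom) (hGfl : Flat G.hom) :
    ∃ (G₀ : Over (Spec (.of R))) (_ : GrpObj G₀) (j : G₀ ⟶ G), IsUnitComponent G G₀ j ∧
      (∀ (R' : Type) [CommRing R'] [IsLocalRing R'] (f : R →+* R') [IsLocalHom f] (t : Spec (.of R') ⟶ G.left),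
          t ≫ G.hom = Spec.map (CommRingCat.ofHom f) →
            ((∃ s : Spec (.of R') ⟶ G₀.left, s ≫ j.left = t) ↔
              Spec.map (CommRingCat.ofHom (residue R')) ≫ t =
                Spec.map (CommRingCat.ofHom ((residue R').comp f)) ≫ η[G].left)) ∧
      (∀ [IsAlgClosed (ResidueField R)] (B : Type) [CommRing B] [Algebra R B] (eB : G.left ≅ Spec (.of B)),
          eB.hom ≫ Spec.map (CommRingCat.ofHom (algebraMap R B)) = G.hom →
        ∀ (B₀ : Type) [CommRing B₀] [Algebra R B₀] (eB₀ : G₀.left ≅ Spec (.of B₀)),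
          eB₀.hom ≫ Spec.map (CommRingCat.ofHom (algebraMap R B₀)) = G₀.hom →
            Module.finrank R B =
              Nat.card {t : Spec (.of (ResidueField R)) ⟶ G.left //
                  t ≫ G.hom = Spec.map (CommRingCat.ofHom (residue R))} * Module.finrank R B₀) := by
  obtain ⟨G₀, inst, j, hj⟩ := stub_b1a_unitComponent R G hGf
  exact ⟨G₀, inst, j, hj, fun R' _ _ f _ t ht => stub_b1b_kernelOfReduction R G G₀ j hGf hj R' f t ht,
    fun B _ _ eB heB B₀ _ _ eB₀ heB₀ => stub_b1c_rankEqCardMulRank R G G₀ j hGf hGfl hj B eB heB B₀ eB₀ heB₀⟩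

/-! ### §6 (b1e) (ED. 2) The special fibre of the unit component is a single point — the P6b half of DICT's (b4′) «canonical line»
(the companion «a connected `Z → G` through the unit factors through `j`» is ★-organ (o-c2d) `GroupSchemes/ConnectedFactorsThroughUnitComponent`
(B-p08), cited not socketed; the DVR forms of (b1d) and «points of a finite flat `Z` specialise from the generic fibre» are banked in the desk, on request) -/

/-- **PAID (ED. 3) `stub_b1e_unitComponentSpecialFibre` := ★ p844903 `F0P6bConnectedEtaleStubB1e.stub_b1e_unitComponentSpecialFibre_holds` (F0P6-p14 (g0)).** (S) — over a henselian local ring the special fibre of a unit component has EXACTLY ONE point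
(`G₀.left = Spec B₀` with `B₀` LOCAL, finite over `R`: the primes over `𝔪_R` are the maximal ideals).  DICT use ((b4′), (o-c2d)): the
specialisation of anything inside `G⁰` is the unit point; `(G_κ̄)⁰ = (G⁰)_κ̄`.  Why it might fail as typed: false for non-henselian `R` (excluded).
[cite: Tate1997FiniteFlatGroupSchemes, (3.7)] [cite: StacksProject, Tag 04GG] -/
theorem stub_b1e_unitComponentSpecialFibre :
    ∀ (R : Type) [CommRing R] [HenselianLocalRing R] (G G₀ : Over (Spec (.of R))) [GrpObj G] [GrpObj G₀] (j : G₀ ⟶ G),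
      IsFinite G.hom → IsUnitComponent G G₀ j →
        Nat.card {x : G₀.left // G₀.hom.base x = closedPoint R} = 1 :=
  -- ED. 3: PAID BY NAME (statement UNCHANGED) — ★ p844903 `Theorems/F0P6bConnectedEtaleStubB1e` (F0P6-p14 (g0) over ★ p844877 `GroupSchemes/FiniteConnectedSpecialFibre`).
  F0P6bConnectedEtaleStubB1e.stub_b1e_unitComponentSpecialFibre_holds

/-! ### §7 (b1g) (ED. 3) Unit components are stable under LOCAL base change — DICT's bridge `(G_κ̄)⁰ = (G⁰)_κ̄`, `(G_{𝒪_Ω})⁰ = (G⁰)_{𝒪_Ω}` -/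

/-- **PAID (ED. 3, born paid) `stub_b1g_unitComponentBaseChange` := ★ p844915 `F0P6bConnectedEtaleStubB1g.stub_b1g_unitComponentBaseChange_holds`
(F0P6-p16 (g0), over ★ p844895 `GroupSchemes/UnitComponentBaseChange.isUnitComponent_baseChange` ← ★ p844861
`Henselian/AugmentedLocalAlgebraBaseChange`).** (M) — `R` henselian local, `G` finite over `Spec R` with unit component `j : G₀ ↪ G`, and
`f : R → R′` a LOCAL homomorphism to a LOCAL ring `R′` (cases of record: `R′ = κ(R)`, `R′ = κ̄`, `𝒪_L → 𝒪_Ω`): the base change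
`j ×_R R′ : G₀ ×_R R′ ↪ G ×_R R′` (Mathlib `Over.pullback`, group objects transported by `Functor.grpObjObj` along the cartesian-monoidal
pull-back, as in ★ `BarsottiTateGroupBaseChange` §0) is again a unit component.  Content = CONNECTEDNESS of `G₀ ×_R R′`: `Γ(G₀)` is a
module-finite LOCAL `R`-algebra with the augmentation of the unit section, and «augmented finite local ⊗ local map stays local» (★ p844861;
sharp: false for `R → Frac R` — `μ_p ⊗ ℚ_p` splits — and without the augmentation).  No finiteness∕henselianity of `R′` needed.  DICT use: compare
`G⁰` over `𝒪_Ω` with P6d's `ker F ⊂ G_κ̄` on the special fibre, and with `(G_Ω)` on the generic fibre.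
[cite: Tate1997FiniteFlatGroupSchemes, (3.7)] [cite: StacksProject, Tag 04GH] -/
theorem stub_b1g_unitComponentBaseChange :
    ∀ (R : Type) [CommRing R] [HenselianLocalRing R] (R' : Type) [CommRing R'] [IsLocalRing R'] (f : R →+* R') [IsLocalHom f]
      (G G₀ : Over (Spec (.of R))) [GrpObj G] [GrpObj G₀] (j : G₀ ⟶ G), IsFinite G.hom → IsUnitComponent G G₀ j →
        letI := Functor.grpObjObj (F := Over.pullback (Spec.map (CommRingCat.ofHom f))) (G := G)
        letI := Functor.grpObjObj (F := Over.pullback (Spec.map (CommRingCat.ofHom f))) (G := G₀)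
        IsUnitComponent ((Over.pullback (Spec.map (CommRingCat.ofHom f))).obj G)
          ((Over.pullback (Spec.map (CommRingCat.ofHom f))).obj G₀) ((Over.pullback (Spec.map (CommRingCat.ofHom f))).map j) :=
  F0P6bConnectedEtaleStubB1g.stub_b1g_unitComponentBaseChange_holds

/-! ### §8 (b1f) (ED. 3) Over an algebraically closed field, a finite group scheme with TRIVIAL unit component is étale — DICT's
`eq_kerF_or_isEtale`, étale branch (the count `#G(k) = rank` is then (b1cg) with `rank G⁰ = 1`) -/

/-- **PAID (ED. 3, born paid, in file) `stub_b1f_etaleOfTrivialUnitComponent`** := conjunct 1 of ★ p844866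
`GroupSchemes/EtaleOfTrivialUnitComponent.etale_and_natCard_eq_of_isUnitComponent_of_isIso` (B-p17 (g26); route «translation automorphisms +
open unit section», no Hopf algebra).  (S–M) — `k` algebraically closed, `G` finite over `Spec k` with unit component `j : G₀ ↪ G` and
`G₀ → Spec k` an ISOMORPHISM (`G⁰ = 1`): then `G → Spec k` is ÉTALE.  (Flatness is automatic over a field; over a general henselian local base
the flat form «`G⁰ ≅ Spec R` ⇒ `G` finite étale» is B-p17's offered (b1f-ii), not socketed.)  Why it might fail as typed: over a NON-perfect
field «`G⁰ = 1` ⇒ étale» still holds for `G⁰` defined as the connected component of the unit (it is geometrically connected, [StacksProject]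
Tag 04KV), but the socket only needs `k = k̄`. [cite: Tate1997FiniteFlatGroupSchemes, (3.7)] [cite: StacksProject, Tag 047N] -/
theorem stub_b1f_etaleOfTrivialUnitComponent :
    ∀ (k : Type) [Field k] [IsAlgClosed k] (G G₀ : Over (Spec (.of k))) [GrpObj G] [GrpObj G₀] (j : G₀ ⟶ G),
      IsFinite G.hom → IsUnitComponent G G₀ j → IsIso G₀.hom → Etale G.hom :=
  fun k _ _ G G₀ _ _ j hG hj hiso =>
    (Literature.AlgebraicGeometry.GroupSchemes.etale_and_natCard_eq_of_isUnitComponent_of_isIso k G G₀ j hG hj hiso).1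

/-! ### §9 (b1h) (ED. 4) A finite scheme over a LOCAL ring with a ONE-POINT special fibre is CONNECTED — HEART (b4′) `canonicalLine`,
uniqueness route (u1) of the hand-over memo (the converse of §6 (b1e); no henselian, flatness or group hypothesis) -/

/-- **PAID (ED. 4, born paid) `stub_b1h_connectedOfOnePointSpecialFibre`** := ★ `GroupSchemes/ConnectedOfOnePointSpecialFibre.connectedSpace_of_natCard_specialFibre_eq_one`
(B-p17 (g26)).  (S) — `R` a local ring, `X → Spec R` FINITE whose fibre over the closed point has exactly one point: then the underlying space of `X` is
connected (`X = Spec Γ(X)`, `Γ(X)` integral over `R`, so the maximal ideals of `Γ(X)` are exactly the primes over `𝔪_R` = the points of the special fibre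
([AtiyahMacdonald1969] Cor. 5.8); one maximal ideal ⇒ `Γ(X)` local ⇒ `Spec Γ(X)` connected).  HEART use ((b4′) uniqueness): the schematic closure
`𝒞 ⊆ 𝒢[ϖ]` over `𝒪_L` ∕ `𝒪_Ω` of a line that specialises to `ker F_q` has a one-point special fibre, so `𝒞` is connected, so `𝒞 ⊆ 𝒢[ϖ]⁰` by ★ (o-c2d)
`ConnectedFactorsThroughUnitComponent.existsUnique_fac_hom`, so `𝒞 = 𝒢[ϖ]⁰` by ★ `Over.isIso_of_isClosedImmersion_of_finrank_eq` (equal rank `q`).  Why it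
might fail as typed: it cannot — no hypothesis beyond `IsLocalRing R` and finiteness is used; the statement is false only for a NON-local base (two closed
points), which the binder excludes. [cite: AtiyahMacdonald1969, Cor. 5.8] [cite: StacksProject, Tag 04GG] -/
theorem stub_b1h_connectedOfOnePointSpecialFibre :
    ∀ (R : Type) [CommRing R] [IsLocalRing R] (X : Over (Spec (.of R))),
      IsFinite X.hom → Nat.card {x : X.left // X.hom.base x = IsLocalRing.closedPoint R} = 1 → ConnectedSpace X.left :=
  Literature.AlgebraicGeometry.GroupSchemes.UnitComponent.connectedSpace_of_natCard_specialFibre_eq_one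

/-! ### §10 (b1k) (ED. 4) The DICHOTOMY CORE over an algebraically closed field — HEART (b) `eq_kerF_or_isEtale`, steps 2–4 of the hand-over
recipe in ONE name: `#G(k) = 1 ⇒ j` is an isomorphism (`G = G⁰`, connected); `#G(k) = rank G ⇒ G` is étale -/

/-- **PAID (ED. 4, born paid) `stub_b1k_isIsoOrEtaleOfNatCard`** := ★ `GroupSchemes/IsIsoOrEtaleOfNatCard.isIso_or_etale_of_natCard_of_presentation`
(F0P3a-p04 (g15); the presentation-free head `isIso_or_etale_of_natCard` states the rank in ★ b1f's `Γ`-currency).  (S) — `k` algebraically closed,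
`G` finite over `Spec k` with unit component `j : G₀ ↪ G` and a presentation `eB : G.left ≅ Spec B` over `k`: (i) if `G` has exactly ONE
`k`-section then `j` is an isomorphism (★ §9-type connectedness ∕ the count (b1cg) `rank G = #G(k) · rank G⁰` + equal-rank rigidity ★ 02KA); (ii) if
`#G(k) = dim_k B = rank G` then `rank G⁰ = 1` and `G` is ÉTALE (★ (b1f) rank-one form).  HEART use ((b) over `κ̄`, `H ∈ Sub x̄` an `𝒪_F`-stable
subgroup scheme of order `q` of `𝒢_x̄[ϖ]`): H1 gives `#H(κ̄) ∈ {1, q}`; (ii) ⇒ `H` étale; (i) ⇒ `H` connected ⇒ `H ⊆ 𝒢[ϖ]⁰` (★ (o-c2d)) ⇒ `H = ker F_q`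
(P6d K-lines) — no étale quotient is needed.  Why it might fail as typed: only a mis-typed presentation (`heB`); both conclusions are guarded by their
count hypotheses. [cite: Tate1997FiniteFlatGroupSchemes, (3.7)] [cite: StacksProject, Tag 02KA] [cite: MumfordAV1970, §12] -/
theorem stub_b1k_isIsoOrEtaleOfNatCard :
    ∀ (k : Type) [Field k] [IsAlgClosed k] (G G₀ : Over (Spec (.of k))) [GrpObj G] [GrpObj G₀] (j : G₀ ⟶ G),
      IsFinite G.hom → IsUnitComponent G G₀ j →
        ∀ (B : Type) [CommRing B] [Algebra k B] (eB : G.left ≅ Spec (.of B)),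
          eB.hom ≫ Spec.map (CommRingCat.ofHom (algebraMap k B)) = G.hom →
            (Nat.card (𝟙_ (Over (Spec (.of k))) ⟶ G) = 1 → IsIso j) ∧
            (Nat.card (𝟙_ (Over (Spec (.of k))) ⟶ G) = Module.finrank k B → Etale G.hom) :=
  Literature.AlgebraicGeometry.GroupSchemes.isIso_or_etale_of_natCard_of_presentation

end Summit.HodgeConjecture.HodgeConjecture.Cruxes.HLiu418.F0P6bConnectedEtale

end
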